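import Literature.IUT.LogThetaLattice.TensorPackets
import Mathlib.RingTheory.TensorProduct.Pi
import Mathlib.Algebra.Algebra.Prod
import HarnessLib

/-!
# [IUTchIII] Proposition 3.1 (ii), direct-summand clause: the typed statement holds for ARBITRARY index sets

S. Mochizuki, *Inter-universal Teichmüller theory III*, kurims manuscript (May 2020) of PRIMS **57**
(2021), §3, Proposition 3.1 (ii), p. 93: "`log(^{A,α}𝓕_v)` forms a direct summand of the ind-topological
ring `log(^A𝓕_{v_ℚ})`" [claim: Mochizuki2012, status: disputed] (D-0012 claim key; the content used here
is undisputed multilinear algebra).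

PROOF-ONLY companion of `TensorPackets.lean` (abc-iut-L6-t4) and `TensorPacketsProofs.lean`.  The typed
reading `Prop31ii_directSummand' 𝕜 L α v` (`∃ C, log(^A𝓕_{v_ℚ}) ≃ₐ[𝕜] log(^{A,α}𝓕_v) × C`) is a `def`
whose section-`variable` instances `[Fintype A] [DecidableEq A] [Fintype Vfib] [DecidableEq Vfib]` are not
referenced by its body and were therefore DROPPED from the constant's type (Lean's section-variable rule;
the cell's finding class G-BINDER-DROP): as a kernel constant it quantifies over ARBITRARY index types `A`
(capsule indices) and `Vfib` (places over `v_ℚ`).  The landed witness `Prop31ii_directSummand'_of_packets`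
assumes `[Fintype A] [Fintype Vfib]` (it distributes the tensor product over the FINITE product
`Π_w log(^α𝓕_w)` with `Algebra.TensorProduct.piRight`), so it proves the universal closure of the
constant only at finite index types (abc-iut FACT-LIST row F-2126, R7 kernel type-audit verdict
DEMOTE:EXTRA-DATA-HYP, abc-iut-w5-d088 gen 2).

This file proves the closure EXACTLY AS TYPED, for arbitrary `A`, `Vfib`: with
`Z := ⊗_{β ≠ α} log(^β𝓕_{v_ℚ})`,
`log(^A𝓕_{v_ℚ}) = ⊗_β Π_w log(^β𝓕_w) ≅ Z ⊗ Π_w log(^α𝓕_w) ≅ Z ⊗ (log(^α𝓕_v) × Π_{w ≠ v} log(^α𝓕_w))`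
`≅ (Z ⊗ log(^α𝓕_v)) × (Z ⊗ Π_{w ≠ v} log(^α𝓕_w)) ≅ log(^{A,α}𝓕_v) × C`
as `𝕜`-algebras — splitting off ONE tensor factor (`PiTensorProduct.tmulEquivDep`, no finiteness) and ONE
factor of a product, and distributing `⊗` over a BINARY product (`Algebra.TensorProduct.prodRight`),
none of which needs the index sets to be finite.  No new definitions; nothing here bears on the reading
of [IUTchIII] Cor. 3.12 (in print `A` and `Vfib` are finite; this only aligns the kernel constant with
its witness).
-/

namespace Literature.IUT.LogThetaLattice

open scoped TensorProduct
open PiTensorProduct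

universe u v v' w

/-! ### Two folklore splittings, with no finiteness hypothesis on the index type -/

/-- Splitting off one factor of a tensor product of commutative algebras over an ARBITRARY index type:
`⊗_{i} M_i ≅ M_a ⊗ (⊗_{i ≠ a} M_i)` as `R`-algebras, with the evident value on pure tensors (Mathlib's
linear equivalences `PiTensorProduct.reindex`, `tmulEquivDep`, `subsingletonEquiv`; multiplicativity is
checked on pure tensors via `liftAlgHom`).  Same construction as the finite-index lemma of
`TensorPacketsProofs.lean`, minus `[Fintype ι]`. [folklore] -/
private theorem exists_algEquiv_piTensorProduct_splitOff {R : Type*} [CommRing R] {ι : Type*}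
    [DecidableEq ι] (M : ι → Type*) [∀ i, CommRing (M i)] [∀ i, Algebra R (M i)] (a : ι) :
    ∃ e : (⨂[R] i, M i) ≃ₐ[R] M a ⊗[R] (⨂[R] i : {i : ι // i ≠ a}, M i.1),
      ∀ x : ∀ i, M i, e (tprod R x) = x a ⊗ₜ tprod R fun i : {i : ι // i ≠ a} => x i.1 := by
  classical
  let σ : {i // i = a} ⊕ {i // ¬i = a} ≃ ι := Equiv.sumCompl fun i => i = a
  let N : {i // i = a} ⊕ {i // ¬i = a} → Type _ := fun j => M (σ.symm.symm j)
  let E₁ : (⨂[R] i, M i) ≃ₗ[R] ⨂[R] j, N j := PiTensorProduct.reindex R M σ.symm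
  let E₂ := (PiTensorProduct.tmulEquivDep R N).symm
  let E₃ : (⨂[R] i₁ : {i // i = a}, N (.inl i₁)) ≃ₗ[R] M a :=
    PiTensorProduct.subsingletonEquiv (⟨a, rfl⟩ : {i // i = a})
  let E : (⨂[R] i, M i) ≃ₗ[R] M a ⊗[R] (⨂[R] i : {i : ι // i ≠ a}, M i.1) :=
    E₁ ≪≫ₗ E₂ ≪≫ₗ TensorProduct.congr E₃ (LinearEquiv.refl R _)
  have hE : ∀ x : ∀ i, M i, E (tprod R x) = x a ⊗ₜ tprod R fun i : {i : ι // i ≠ a} => x i.1 := by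
    intro x
    have h1 : E₃ (tprod R fun i₁ : {i // i = a} => x (σ.symm.symm (.inl i₁))) = x a :=
      PiTensorProduct.subsingletonEquiv_apply_tprod _ _
    have h2 : E (tprod R x) =
        E₃ (tprod R fun i₁ : {i // i = a} => x (σ.symm.symm (.inl i₁))) ⊗ₜ[R]
          tprod R fun i₂ : {i // ¬i = a} => x (σ.symm.symm (.inr i₂)) := by
      simp only [E, E₁, E₂, N, LinearEquiv.trans_apply, PiTensorProduct.reindex_tprod,
        PiTensorProduct.tmulEquivDep_symm_apply, TensorProduct.congr_tmul]
      rfl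
    rw [h2, h1]
    rfl
  let φ : MultilinearMap R M (M a ⊗[R] (⨂[R] i : {i : ι // i ≠ a}, M i.1)) :=
    (E : (⨂[R] i, M i) →ₗ[R] _).compMultilinearMap (tprod R)
  have hφ : ∀ x, φ x = x a ⊗ₜ tprod R fun i : {i : ι // i ≠ a} => x i.1 := fun x => hE x
  let f : (⨂[R] i, M i) →ₐ[R] M a ⊗[R] (⨂[R] i : {i : ι // i ≠ a}, M i.1) :=
    PiTensorProduct.liftAlgHom φ (by rw [hφ]; rfl) fun x y => by
      rw [hφ, hφ, hφ, Algebra.TensorProduct.tmul_mul_tmul, tprod_mul_tprod]; rfl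
  have hf : ∀ z, f z = E z := by
    have h : f.toLinearMap = (E : (⨂[R] i, M i) →ₗ[R] _) :=
      PiTensorProduct.ext (MultilinearMap.ext fun x => by
        simp only [LinearMap.compMultilinearMap_apply, AlgHom.toLinearMap_apply, f,
          PiTensorProduct.liftAlgHom_apply, PiTensorProduct.lift.tprod, φ, LinearEquiv.coe_coe])
    exact fun z => LinearMap.congr_fun h z
  have hbij : Function.Bijective f := by
    have : (f : (⨂[R] i, M i) → _) = E := funext hf
    rw [this]; exact E.bijective
  exact ⟨AlgEquiv.ofBijective f hbij, fun x => by
    rw [AlgEquiv.ofBijective_apply, hf, hE]⟩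

/-- Splitting off one factor of a product of algebras over an ARBITRARY index type:
`Π_i Y_i ≅ Y_a × Π_{i ≠ a} Y_i` as `R`-algebras. [folklore] -/
private theorem exists_algEquiv_pi_splitOff (R : Type*) [CommSemiring R] {ι : Type*} [DecidableEq ι]
    (Y : ι → Type*) [∀ i, Semiring (Y i)] [∀ i, Algebra R (Y i)] (a : ι) :
    ∃ e : (∀ i, Y i) ≃ₐ[R] Y a × (∀ i : {i : ι // i ≠ a}, Y i.1),
      ∀ f : ∀ i, Y i, e f = (f a, fun i : {i : ι // i ≠ a} => f i.1) := by
  let φ : (∀ i, Y i) →ₐ[R] Y a × (∀ i : {i : ι // i ≠ a}, Y i.1) :=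
    (Pi.evalAlgHom R Y a).prod (AlgHom.pi fun i : {i : ι // i ≠ a} => Pi.evalAlgHom R Y i.1)
  have hφ : ∀ f : ∀ i, Y i, φ f = (f a, fun i : {i : ι // i ≠ a} => f i.1) := fun f => rfl
  refine ⟨AlgEquiv.ofBijective φ ⟨fun f g h => ?_, fun yg => ?_⟩, fun f => by
    rw [AlgEquiv.ofBijective_apply, hφ]⟩
  · rw [hφ, hφ, Prod.mk.injEq] at h
    funext i
    by_cases hi : i = a
    · subst hi; exact h.1
    · exact congr_fun h.2 ⟨i, hi⟩
  · obtain ⟨y, g⟩ := yg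
    refine ⟨Function.update (fun i => if h : i ≠ a then g ⟨i, h⟩ else 0) a y, ?_⟩
    rw [hφ, Prod.mk.injEq]
    refine ⟨Function.update_self .., funext fun i => ?_⟩
    rw [Function.update_of_ne i.2, dif_pos i.2]

/-! ### Proposition 3.1 (ii), direct-summand clause, for arbitrary index sets -/

/-- **IUTchIII:Prop3.1(ii)** (p. 93), "`log(^{A,α}𝓕_v)` forms a direct summand of the
[ind-topological] ring `log(^A𝓕_{v_ℚ})`", typed reading `Prop31ii_directSummand'` — FACT-LIST F-2126: the
UNIVERSAL CLOSURE of the kernel constant exactly as typed (binders `𝕜, [Field 𝕜], A, Vfib, L, [CommRing],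
[Algebra], α, v` — NO `Fintype`/`DecidableEq` on the index sets `A`, `Vfib`), PROVED: with
`Z := ⊗_{β ≠ α} log(^β𝓕_{v_ℚ})`,
`log(^A𝓕_{v_ℚ}) ≅ Z ⊗ (log(^α𝓕_v) × Π_{w ≠ v} log(^α𝓕_w)) ≅ log(^{A,α}𝓕_v) × (Z ⊗ Π_{w ≠ v} log(^α𝓕_w))`.
(Stated in closed `∀`-form on purpose: it is the closure itself, not an instance-form twin of the
finite-index witness `Prop31ii_directSummand'_of_packets`.) [claim: Mochizuki2012, status: disputed] -/
theorem Prop31ii_directSummand'_closure :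
    ∀ (𝕜 : Type u) [Field 𝕜] {A : Type v} {Vfib : Type v'} (L : A → Vfib → Type w)
      [∀ α v, CommRing (L α v)] [∀ α v, Algebra 𝕜 (L α v)] (α : A) (v : Vfib),
      Prop31ii_directSummand' 𝕜 L α v := by
  intro 𝕜 _ A Vfib L _ _ α v
  classical
  obtain ⟨e₁, -⟩ := exists_algEquiv_piTensorProduct_splitOff (R := 𝕜) (fun β => Packet1 L β) α
  obtain ⟨e₂, -⟩ := exists_algEquiv_pi_splitOff 𝕜 (L α) v
  refine ⟨(⨂[𝕜] β : {β : A // β ≠ α}, Packet1 L β.1) ⊗[𝕜] (∀ w : {w : Vfib // w ≠ v}, L α w.1),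
    inferInstance, inferInstance, ⟨?_⟩⟩
  exact e₁.trans <| (Algebra.TensorProduct.comm 𝕜 _ _).trans <|
    (Algebra.TensorProduct.congr AlgEquiv.refl e₂).trans <|
      (Algebra.TensorProduct.prodRight 𝕜 𝕜 _ (L α v) _).trans <|
        AlgEquiv.prodCongr (Algebra.TensorProduct.comm 𝕜 _ _) AlgEquiv.refl

end Literature.IUT.LogThetaLattice
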